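import Literature.AlgebraicGeometry.Resolution.SpreadsShapedNonSmoothLocus
import Literature.AlgebraicGeometry.Resolution.SpreadShapeData
import Literature.AlgebraicGeometry.Resolution.SpreadModelDataSpread
import Literature.AlgebraicGeometry.Resolution.CanonicalResolutionSpread
import Literature.AlgebraicGeometry.Resolution.CanonicalResolutionKollar
import Literature.AlgebraicGeometry.Limits.NonIntegralFibresSpread
import Mathlib.AlgebraicGeometry.FunctionField
import HarnessLib

/-!
# The spreading-out step `SpreadsShapedFromGenericPoint` (BGMW 2011, Thm. 8.0.5 from characteristic zero)

Topic: `Literature/AlgebraicGeometry/Resolution`. PROOF of the spreading-out step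
`SpreadsShapedFromGenericPoint n d l` of `CanonicalResolutionSpread.lean`, the hypothesis (β) of
`canonical_of_charZero_of_spreads` (and of `canonical_of_kollarThms_of_spreads`,
`CanonicalResolutionKollar.lean`) in the reduction of the named fact
`BierstoneGrigorievMilmanWlodarczyk2011_canonical` (Bierstone–Grigoriev–Milman–Włodarczyk,
arXiv:1206.3090, Thm. 8.0.5 with Cor. 8.0.6–8.0.7) to characteristic zero:

  if the universal instance over the fraction field `K` of `A = ℤ[c]/𝔮` has a shaped resolution,
  then so has the instance at every PERFECT-field-valued point of some `D(f)`, `f ∉ 𝔮`.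

Clause (i) first (`exists_modelData_univFamily` — the model: `a ≠ 0` and `s` with `s^*jK = s_K`
and `ModelData` on the restriction over `D(a)`; `isResolutionOf_comap_univFamily` — for
`φ : A → k` with `φ a ≠ 0`, `s^*ι_φ` is a resolution of `(𝔸ⁿ_k, 𝓘_{V(F_φ)}, ∅, 1)`), then the
assembly (`hasShapedResolution_spread`, for any Noetherian domain `A` with fraction field of
characteristic zero, and `spreadsShapedFromGenericPoint_holds`):
* the model tower `s` over `𝔸ⁿ_A` of the generic resolution (`SpreadModelTower.lean`) carries
  model data over some `D(a₁)` (`SpreadModelDataSpread.lean`), which restrict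
  (`SpreadModelDataRestrict.lean`) and make every fibre over `D(a₁)` a resolution of
  `(𝔸ⁿ_k, 𝓘_{V(F_φ)}, ∅, 1)` (`SpreadModelData.lean`) — clause (i);
* clause (ii): if the generic zero scheme `Y_K` is NOT integral, no zero scheme over some `D(b)`
  is (`Limits.exists_forall_not_isDomain_mvPolynomial`, generic freeness) and the clause is
  vacuous; if it is integral, the generic clause (ii) applied to the complement of the preimage
  of `Z_A` (the image of the non-smooth locus of the flat part of `Y_A → Spec A`,
  `SpreadsShapedNonSmoothLocus.lean`; it meets `Y_K` at its generic point and inside its regular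
  locus, the regular locus of a perfect-field-valued fibre being the preimage of the smooth
  locus) says that `s_K` is the single blow-up of `𝓘` off `Z_A` (`BlowupSequencesSingleOff.lean`),
  a shape which spreads to the restriction of `s` over some `D(a₂)` (`SpreadShapeData.lean`),
  passes to the fibres (`IsSingleOff.comap`) and yields clause (ii) for every open of `𝔸ⁿ_k`
  meeting `V(F_φ)` inside its regular locus (`IsSingleOff.isExtensionOfSingle_restrict`).

Consequences: `canonical_of_charZero` and `canonical_of_kollarThms` — the named fact
`BierstoneGrigorievMilmanWlodarczyk2011_canonical` now follows from its characteristic-zero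
counterpart (C0') alone, resp. from the two Kollár leaves `Kollar2007Thm3_103`,
`Kollar2007Thm3_107` of the tree.

## Sources

* E. Bierstone, D. Grigoriev, P. Milman, J. Włodarczyk, *Effective Hironaka resolution and its
  complexity*, Asian J. Math. 15 (2011) 193–228, arXiv:1206.3090: Thm. 8.0.5, Cor. 8.0.6–8.0.7,
  Def. 3.1.3, Def. 3.1.5. [BierstoneGrigorievMilmanWlodarczyk2011]
* A. Grothendieck, J. Dieudonné, EGA IV₃ (1966), §8–§9, §12; EGA IV₂ 6.9.1. [folklore]
* U. Görtz, T. Wedhorn, *Algebraic Geometry I*, 2nd ed. (2020), Thm. 10.83. [GortzWedhorn2020]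
-/

noncomputable section

open CategoryTheory CategoryTheory.Limits AlgebraicGeometry TopologicalSpace MvPolynomial
  PrimeSpectrum

namespace Literature.AlgebraicGeometry.Resolution

open Scheme.IdealSheafData

attribute [local instance] MvPolynomial.algebraMvPolynomial

/-! ## Clause (i): the model and its fibres -/

section AffineSpace

variable {n : ℕ}

/-- **`𝔸ⁿ_k` has simple normal crossings with the empty boundary** (it is a regular scheme).
[folklore] -/
theorem hasSNC_nil_affineSpace (k : Type) [Field k] :
    HasSNC ([] : List (Spec (CommRingCat.of (MvPolynomial (Fin n) k))).IdealSheafData) := by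
  have hX : Scheme.IsRegular (Spec (CommRingCat.of (MvPolynomial (Fin n) k))) :=
    (Scheme.isRegular_Spec_iff (CommRingCat.of (MvPolynomial (Fin n) k))).mpr inferInstance
  refine hasSNCWith_nil_of_isRegular hX fun x => isEmptyElim (α := (⊤ : (Spec (CommRingCat.of
    (MvPolynomial (Fin n) k))).IdealSheafData).subscheme) x

end AffineSpace

section Model

variable {n d l : ℕ} {A : Type} [CommRing A] [IsDomain A] [IsNoetherianRing A] (K : Type) [Field K]
  [CharZero K] [Algebra A K] [IsFractionRing A K] (f : CoeffRing n d l →+* A)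

/-- **The model of a generic resolution** (see the module docstring): over a Noetherian domain `A`
with fraction field `K` of characteristic zero (in the application `A = ℤ[c]/𝔮`), `a ≠ 0` in `A`
and a multiple blow-up `s` of `𝔸ⁿ_A` inducing the given resolution `s_K` of the generic member on
`𝔸ⁿ_K` and carrying global model data over `D(a)`.
[cite: BierstoneGrigorievMilmanWlodarczyk2011, Thm. 8.0.5 with Cor. 8.0.6–8.0.7] -/
theorem exists_modelData_univFamily
    (sK : CentreSeq (Spec (CommRingCat.of (MvPolynomial (Fin n) K))))
    (hres : sK.IsResolutionOf
      ⟨(affineZeroLocusι K n (univFamily n d l ((algebraMap A K).comp f))).ker, [], 1⟩) :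
    ∃ (a : A) (s : CentreSeq (Spec (CommRingCat.of (MvPolynomial (Fin n) A)))), a ≠ 0 ∧
      s.comap (Spec.map (CommRingCat.ofHom (MvPolynomial.map (algebraMap A K)))) = sK ∧
      CentreSeq.ModelData
        ((Spec.map (CommRingCat.ofHom (algebraMap A (MvPolynomial (Fin n) A))) ⁻¹ᵁ basicOpen a).ι ≫
          Spec.map (CommRingCat.ofHom (algebraMap A (MvPolynomial (Fin n) A))))
        (s.restrict ((Spec.map (CommRingCat.ofHom (algebraMap A (MvPolynomial (Fin n) A)))) ⁻¹ᵁ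
          basicOpen a).ι)
        ((affineBlowup.idealSheaf (Ideal.span (univFamily n d l f : Set (MvPolynomial (Fin n) A)))).comap
          ((Spec.map (CommRingCat.ofHom (algebraMap A (MvPolynomial (Fin n) A)))) ⁻¹ᵁ basicOpen a).ι)
        List.nil := by
  -- the affine spaces and the generic square
  set q : Spec (CommRingCat.of (MvPolynomial (Fin n) A)) ⟶ Spec (.of A) :=
    Spec.map (CommRingCat.ofHom (algebraMap A (MvPolynomial (Fin n) A))) with hq
  set jK : Spec (CommRingCat.of (MvPolynomial (Fin n) K)) ⟶ Spec (CommRingCat.of (MvPolynomial (Fin n) A)) :=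
    Spec.map (CommRingCat.ofHom (MvPolynomial.map (algebraMap A K))) with hjK
  set qK : Spec (CommRingCat.of (MvPolynomial (Fin n) K)) ⟶ Spec (.of K) :=
    Spec.map (CommRingCat.ofHom (algebraMap K (MvPolynomial (Fin n) K))) with hqK
  have HK : IsPullback jK qK q (specOfAlgebra A K) := isPullback_specMap_mvPolynomial_map A K
  haveI : LocallyOfFiniteType q := by
    rw [hq, HasRingHomProperty.Spec_iff (P := @LocallyOfFiniteType)]
    exact RingHom.finiteType_algebraMap.mpr inferInstance
  haveI : LocallyOfFiniteType qK := by
    rw [hqK, HasRingHomProperty.Spec_iff (P := @LocallyOfFiniteType)]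
    exact RingHom.finiteType_algebraMap.mpr inferInstance
  haveI : IsLocallyNoetherian (Spec (CommRingCat.of (MvPolynomial (Fin n) K))) := inferInstance
  -- the ideal sheaf of `V(F)` and its generic restriction
  set 𝓘 : (Spec (CommRingCat.of (MvPolynomial (Fin n) A))).IdealSheafData :=
    affineBlowup.idealSheaf (Ideal.span (univFamily n d l f : Set (MvPolynomial (Fin n) A))) with h𝓘
  have h𝓘K : (affineZeroLocusι K n (univFamily n d l ((algebraMap A K).comp f))).ker = 𝓘.comap jK :=
    ker_affineZeroLocusι_univFamily f K (algebraMap A K)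
  -- the model tower
  obtain ⟨s, hs⟩ := CentreSeq.exists_comap_eq_of_isPullback_generic K sK q jK qK HK
  have hres' : (s.comap jK).IsResolutionOf ⟨𝓘.comap jK, [], 1⟩ := by
    rw [hs, ← h𝓘K]
    exact hres
  -- model data over some `D(a)`, restricted
  obtain ⟨a, ha, hMD⟩ := CentreSeq.exists_modelDataAt K s q jK qK HK 𝓘 [] hres'
  refine ⟨a, s, ha, hs, ?_⟩
  have h := CentreSeq.ModelDataAt.modelData_restrict a s q jK 𝓘 [] hMD (q ⁻¹ᵁ basicOpen a).ι
    fun x => by rw [Scheme.Opens.range_ι]; rfl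
  rwa [List.map_nil] at h

omit [IsDomain A] in
/-- **Clause (i) in the fibres**: with `a`, `s` as in `exists_modelData_univFamily`, for every
field-valued point `φ : A → k` with `φ a ≠ 0` the induced sequence `s^*ι_φ` on `𝔸ⁿ_k` is a
resolution (BGMW Def. 3.1.3) of the marked ideal `(𝔸ⁿ_k, 𝓘_{V(F_φ)}, ∅, 1)`.
[cite: BierstoneGrigorievMilmanWlodarczyk2011, Thm. 8.0.5 with Cor. 8.0.6–8.0.7 and Def. 3.1.3] -/
theorem isResolutionOf_comap_univFamily {a : A}
    {s : CentreSeq (Spec (CommRingCat.of (MvPolynomial (Fin n) A)))}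
    (hMD : CentreSeq.ModelData
        ((Spec.map (CommRingCat.ofHom (algebraMap A (MvPolynomial (Fin n) A))) ⁻¹ᵁ basicOpen a).ι ≫
          Spec.map (CommRingCat.ofHom (algebraMap A (MvPolynomial (Fin n) A))))
        (s.restrict ((Spec.map (CommRingCat.ofHom (algebraMap A (MvPolynomial (Fin n) A)))) ⁻¹ᵁ
          basicOpen a).ι)
        ((affineBlowup.idealSheaf (Ideal.span (univFamily n d l f : Set (MvPolynomial (Fin n) A)))).comap
          ((Spec.map (CommRingCat.ofHom (algebraMap A (MvPolynomial (Fin n) A)))) ⁻¹ᵁ basicOpen a).ι)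
        List.nil)
    (k : Type) [Field k] (φ : A →+* k) (hφ : φ a ≠ 0) :
    (s.comap (Spec.map (CommRingCat.ofHom (MvPolynomial.map φ)))).IsResolutionOf
      ⟨(affineZeroLocusι k n (univFamily n d l (φ.comp f))).ker, [], 1⟩ := by
  letI : Algebra A k := φ.toAlgebra
  set q : Spec (CommRingCat.of (MvPolynomial (Fin n) A)) ⟶ Spec (.of A) :=
    Spec.map (CommRingCat.ofHom (algebraMap A (MvPolynomial (Fin n) A))) with hq
  set ι : Spec (CommRingCat.of (MvPolynomial (Fin n) k)) ⟶ Spec (CommRingCat.of (MvPolynomial (Fin n) A)) :=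
    Spec.map (CommRingCat.ofHom (MvPolynomial.map φ)) with hι
  set sk : Spec (CommRingCat.of (MvPolynomial (Fin n) k)) ⟶ Spec (.of k) :=
    Spec.map (CommRingCat.ofHom (algebraMap k (MvPolynomial (Fin n) k))) with hsk
  have hφalg : (algebraMap A k : A →+* k) = φ := rfl
  have HX : IsPullback ι sk q (Spec.map (CommRingCat.ofHom φ)) := by
    have h := isPullback_specMap_mvPolynomial_map (n := n) A k
    rwa [hφalg] at h
  haveI : LocallyOfFiniteType q := by
    rw [hq, HasRingHomProperty.Spec_iff (P := @LocallyOfFiniteType)]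
    exact RingHom.finiteType_algebraMap.mpr inferInstance
  -- the fibre factors through `q⁻¹ D(a)`
  obtain ⟨ι₀, hι₀, H₀⟩ := exists_lift_isPullback_of_apply_ne_zero q a φ hφ HX
  haveI : IsLocallyNoetherian (Spec (CommRingCat.of (MvPolynomial (Fin n) A))) :=
    LocallyOfFiniteType.isLocallyNoetherian q
  haveI : IsLocallyNoetherian (Spec (CommRingCat.of (MvPolynomial (Fin n) k))) := inferInstance
  have H₀' : IsPullback ι₀ sk ((q ⁻¹ᵁ basicOpen a).ι ≫ q) (specOfAlgebra A k) := by
    rw [show specOfAlgebra A k = Spec.map (CommRingCat.ofHom φ) from rfl]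
    exact H₀
  have key := CentreSeq.ModelData.isResolutionOf_comap _ _ _ _ hMD ι₀ sk H₀' (by
    rw [List.map_nil]; exact hasSNC_nil_affineSpace k)
  -- rewrite the induced sequence and the marked ideal
  rw [List.map_nil, CentreSeq.restrict_eq_comap, ← CentreSeq.comap_comp,
    ← Scheme.IdealSheafData.comap_comp, hι₀] at key
  rw [ker_affineZeroLocusι_univFamily, ← hι]
  exact key

end Model

/-! ## Generalities on the zero schemes -/

section ZeroLocus

variable {n : ℕ}

/-- `V(S) = Spec (k[x]/(S))` is integral iff `k[x]/(S)` is an integral domain. [folklore] -/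
theorem isIntegral_affineZeroLocus_iff (k : Type) [Field k] (S : Finset (MvPolynomial (Fin n) k)) :
    IsIntegral (affineZeroLocus k n S) ↔
      IsDomain (MvPolynomial (Fin n) k ⧸ Ideal.span (S : Set (MvPolynomial (Fin n) k))) := by
  delta affineZeroLocus
  exact affine_isIntegral_iff _

variable {d l : ℕ} {A : Type} [CommRing A] (f : CoeffRing n d l →+* A)

/-- `(F)·k[x] = (F_φ)`. [folklore] -/
theorem map_univIdeal (k : Type) [CommRing k] (φ : A →+* k) :
    (univIdeal f).map (MvPolynomial.map φ) =
      Ideal.span (univFamily n d l (φ.comp f) : Set (MvPolynomial (Fin n) k)) := by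
  classical
  rw [Ideal.map_span, univFamily_comp, Finset.coe_image]

end ZeroLocus

/-! ## Clause (ii) in the fibres from the shape of the model -/

section ClauseTwo

variable {n d l : ℕ} {A : Type} [CommRing A] [IsNoetherianRing A] (f : CoeffRing n d l →+* A)

/-- **Clause (ii) in a fibre from the shape "single blow-up of `𝓘` off `Z_A`"**: if `Y_A` is flat
over `D(b)`, `k` is perfect, `φ(b) ≠ 0` and the sequence `s_k` on `𝔸ⁿ_k` is the single blow-up of
`𝓘_{V(F_φ)}` off the preimage of `Z_A`, then for every open immersion `j : U → 𝔸ⁿ_k` meeting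
`V(F_φ)` inside its regular locus, `s_k|U` is an extension of the one-step sequence along
`𝓘_{V(F_φ)}|U` (the regular points of `V(F_φ)` do not lie over `Z_A`).
[cite: BierstoneGrigorievMilmanWlodarczyk2011, Thm. 8.0.5 (2) with Def. 3.1.5] -/
theorem isExtensionOfSingle_restrict_of_isSingleOff {b : A}
    (hflat : Flat (((modelZeroLocusToSpec f) ⁻¹ᵁ basicOpen b).ι ≫ modelZeroLocusToSpec f))
    (k : Type) [Field k] [PerfectField k] (φ : A →+* k) (hφ : φ b ≠ 0)
    {sk : CentreSeq (Spec (CommRingCat.of (MvPolynomial (Fin n) k)))}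
    (h : sk.IsSingleOff
      ((Spec.map (CommRingCat.ofHom (MvPolynomial.map φ))) ⁻¹' modelSingLocus f)
      (affineZeroLocusι k n (univFamily n d l (φ.comp f))).ker)
    {U : Scheme.{0}} (j : U ⟶ Spec (CommRingCat.of (MvPolynomial (Fin n) k))) [IsOpenImmersion j]
    (hreg : ∀ y : affineZeroLocus k n (univFamily n d l (φ.comp f)),
      affineZeroLocusι k n (univFamily n d l (φ.comp f)) y ∈ Set.range j →
        IsRegularLocalRing ((affineZeroLocus k n (univFamily n d l (φ.comp f))).presheaf.stalk y)) :
    (sk.restrict j).IsExtensionOfSingle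
      ((affineZeroLocusι k n (univFamily n d l (φ.comp f))).ker.comap j) := by
  refine h.isExtensionOfSingle_restrict j ?_
  rintro _ ⟨v, rfl⟩ hv
  obtain ⟨y, hy⟩ := exists_eq_of_specMap_mem_range_modelZeroLocusι f k φ (j v)
    (modelSingLocus_subset_range f hv)
  have hregy := hreg y ⟨v, hy.symm⟩
  rw [isRegularLocalRing_stalk_iff_not_mem_modelSingLocus f k φ hflat hφ y, hy] at hregy
  exact hregy hv

end ClauseTwo

/-! ## The spreading-out theorem -/

section Spread

variable {n d l : ℕ} {A : Type} [CommRing A] [IsDomain A] [IsNoetherianRing A] (K : Type) [Field K]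
  [CharZero K] [Algebra A K] [IsFractionRing A K] (f : CoeffRing n d l →+* A)

/-- **The shape spreads (integral generic zero scheme).** Let `s` be a multiple blow-up of
`𝔸ⁿ_A` whose generic fibre `s_K` satisfies clause (ii) for the (integral) generic zero scheme
`Y_K = V(F_K)`, and let `Y_A` be flat over `D(b)`, `b ≠ 0`. Then there is `a ≠ 0` such that for
every field-valued point `φ` of `D(a)` the fibre `s_φ` on `𝔸ⁿ_k` is the single blow-up of
`𝓘_{V(F_φ)}` off the preimage of `Z_A`. (The generic clause (ii) is applied to the complement `W`
of the preimage of `Z_A`, which contains the generic point of `Y_K` and meets `Y_K` inside its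
regular locus; the resulting shape `IsSingleOff` spreads by `exists_isSingleOff_restrict` and
passes to the fibres by `IsSingleOff.comap`.)
[cite: BierstoneGrigorievMilmanWlodarczyk2011, Thm. 8.0.5 (2) with Cor. 8.0.6–8.0.7] -/
theorem exists_forall_isSingleOff_comap
    (s : CentreSeq (Spec (CommRingCat.of (MvPolynomial (Fin n) A))))
    (hint : IsIntegral (affineZeroLocus K n (univFamily n d l ((algebraMap A K).comp f))))
    (hii : ∀ (U : Scheme.{0}) (j : U ⟶ Spec (CommRingCat.of (MvPolynomial (Fin n) K)))
      [IsOpenImmersion j],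
      (∃ y : affineZeroLocus K n (univFamily n d l ((algebraMap A K).comp f)),
        affineZeroLocusι K n (univFamily n d l ((algebraMap A K).comp f)) y ∈ Set.range j) →
      (∀ y : affineZeroLocus K n (univFamily n d l ((algebraMap A K).comp f)),
        affineZeroLocusι K n (univFamily n d l ((algebraMap A K).comp f)) y ∈ Set.range j →
          IsRegularLocalRing
            ((affineZeroLocus K n (univFamily n d l ((algebraMap A K).comp f))).presheaf.stalk y)) →
      ((s.comap (Spec.map (CommRingCat.ofHom (MvPolynomial.map (algebraMap A K))))).restrict j).IsExtensionOfSingle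
        ((affineZeroLocusι K n (univFamily n d l ((algebraMap A K).comp f))).ker.comap j))
    {b : A} (hb : b ≠ 0)
    (hflat : Flat (((modelZeroLocusToSpec f) ⁻¹ᵁ basicOpen b).ι ≫ modelZeroLocusToSpec f)) :
    ∃ a : A, a ≠ 0 ∧ ∀ (k : Type) [Field k] (φ : A →+* k), φ a ≠ 0 →
      (s.comap (Spec.map (CommRingCat.ofHom (MvPolynomial.map φ)))).IsSingleOff
        ((Spec.map (CommRingCat.ofHom (MvPolynomial.map φ))) ⁻¹' modelSingLocus f)
        ((affineBlowup.idealSheaf (univIdeal f)).comap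
          (Spec.map (CommRingCat.ofHom (MvPolynomial.map φ)))) := by
  -- the affine spaces and the generic square
  set q : Spec (CommRingCat.of (MvPolynomial (Fin n) A)) ⟶ Spec (.of A) :=
    Spec.map (CommRingCat.ofHom (algebraMap A (MvPolynomial (Fin n) A))) with hq
  set jK : Spec (CommRingCat.of (MvPolynomial (Fin n) K)) ⟶ Spec (CommRingCat.of (MvPolynomial (Fin n) A)) :=
    Spec.map (CommRingCat.ofHom (MvPolynomial.map (algebraMap A K))) with hjK
  set qK : Spec (CommRingCat.of (MvPolynomial (Fin n) K)) ⟶ Spec (.of K) :=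
    Spec.map (CommRingCat.ofHom (algebraMap K (MvPolynomial (Fin n) K))) with hqK
  have HK : IsPullback jK qK q (specOfAlgebra A K) := isPullback_specMap_mvPolynomial_map A K
  haveI : LocallyOfFiniteType q := by
    rw [hq, HasRingHomProperty.Spec_iff (P := @LocallyOfFiniteType)]
    exact RingHom.finiteType_algebraMap.mpr inferInstance
  haveI : IsLocallyNoetherian (Spec (CommRingCat.of (MvPolynomial (Fin n) K))) := inferInstance
  set 𝓘 : (Spec (CommRingCat.of (MvPolynomial (Fin n) A))).IdealSheafData :=
    affineBlowup.idealSheaf (univIdeal f) with h𝓘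
  set Z : Set (Spec (CommRingCat.of (MvPolynomial (Fin n) A))) := modelSingLocus f with hZdef
  have hZ : IsClosed Z := isClosed_modelSingLocus f
  have h𝓘K : (affineZeroLocusι K n (univFamily n d l ((algebraMap A K).comp f))).ker = 𝓘.comap jK :=
    ker_affineZeroLocusι_univFamily f K (algebraMap A K)
  -- ### the generic shape: `s_K` is the single blow-up of `𝓘` off `jK⁻¹ Z`
  have hbK : algebraMap A K b ≠ 0 := fun h =>
    hb ((IsFractionRing.injective A K) (by rw [h, map_zero]))
  haveI := hint
  set YK := affineZeroLocus K n (univFamily n d l ((algebraMap A K).comp f)) with hYK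
  set yιK := affineZeroLocusι K n (univFamily n d l ((algebraMap A K).comp f)) with hyιK
  have hregK : ∀ y : YK, IsRegularLocalRing (YK.presheaf.stalk y) ↔ jK (yιK y) ∉ Z := fun y =>
    isRegularLocalRing_stalk_iff_not_mem_modelSingLocus f K (algebraMap A K) hflat hbK y
  let W : (Spec (CommRingCat.of (MvPolynomial (Fin n) K))).Opens :=
    ⟨(jK ⁻¹' Z)ᶜ, (hZ.preimage jK.continuous).isOpen_compl⟩
  have hWrange : Set.range W.ι = (jK ⁻¹' Z)ᶜ := Scheme.Opens.range_ι W
  have hgen : (s.comap jK).IsSingleOff (jK ⁻¹' Z) (𝓘.comap jK) := by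
    have h1 : ∃ y : YK, yιK y ∈ Set.range W.ι := by
      refine ⟨genericPoint YK, ?_⟩
      rw [hWrange]
      -- the stalk at the generic point is the function field, a regular local ring
      -- (`IsRegularLocalRing.instOfIsLocalRingOfIsDomainOfIsPrincipalIdealRing`)
      exact (hregK (genericPoint YK)).mp inferInstance
    have h2 : ∀ y : YK, yιK y ∈ Set.range W.ι → IsRegularLocalRing (YK.presheaf.stalk y) := by
      intro y hy
      rw [hWrange] at hy
      exact (hregK y).mpr hy
    have h3 := hii W W.ι h1 h2
    have h4 := CentreSeq.isSingleOff_of_isExtensionOfSingle_restrict (s.comap jK) _ W.ι h3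
    rwa [hWrange, compl_compl, h𝓘K] at h4
  -- ### spread the shape over some `D(a)`
  obtain ⟨a, ha, hSO⟩ := CentreSeq.exists_isSingleOff_restrict K s q jK qK HK 𝓘 hZ hgen
  refine ⟨a, ha, fun k _ φ hφ => ?_⟩
  -- the fibre at `φ` factors through `q⁻¹ D(a)`
  letI : Algebra A k := φ.toAlgebra
  set ι : Spec (CommRingCat.of (MvPolynomial (Fin n) k)) ⟶ Spec (CommRingCat.of (MvPolynomial (Fin n) A)) :=
    Spec.map (CommRingCat.ofHom (MvPolynomial.map φ)) with hι
  set sk : Spec (CommRingCat.of (MvPolynomial (Fin n) k)) ⟶ Spec (.of k) :=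
    Spec.map (CommRingCat.ofHom (algebraMap k (MvPolynomial (Fin n) k))) with hsk
  have hφalg : (algebraMap A k : A →+* k) = φ := rfl
  have HX : IsPullback ι sk q (Spec.map (CommRingCat.ofHom φ)) := by
    have h := isPullback_specMap_mvPolynomial_map (n := n) A k
    rwa [hφalg] at h
  obtain ⟨ι₀, hι₀, -⟩ := exists_lift_isPullback_of_apply_ne_zero q a φ hφ HX
  have key := (hSO a le_rfl (q ⁻¹ᵁ basicOpen a).ι (fun x => by rw [Scheme.Opens.range_ι]; rfl)).comap ι₀
  rw [CentreSeq.restrict_eq_comap, ← CentreSeq.comap_comp, ← Scheme.IdealSheafData.comap_comp,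
    ← Set.preimage_comp, ← TopCat.coe_comp, ← Scheme.Hom.comp_base, hι₀] at key
  exact key

/-- **Spreading out a shaped resolution from the generic fibre** (the content of
`SpreadsShapedFromGenericPoint`, over any Noetherian domain `A` whose fraction field `K` has
characteristic zero): if the instance of the universal family at the generic point has a shaped
resolution, then so has the instance at every perfect-field-valued point of some `D(a)`, `a ≠ 0`.
[cite: BierstoneGrigorievMilmanWlodarczyk2011, Thm. 8.0.5 with Cor. 8.0.6–8.0.7] -/
theorem hasShapedResolution_spread
    (hK : HasShapedResolution K n (univFamily n d l ((algebraMap A K).comp f))) :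
    ∃ a : A, a ≠ 0 ∧ ∀ (k : Type) [Field k] [PerfectField k] (φ : A →+* k), φ a ≠ 0 →
      HasShapedResolution k n (univFamily n d l (φ.comp f)) := by
  classical
  obtain ⟨sK, hresK, hiiK⟩ := hK
  -- the affine spaces and the generic square
  set q : Spec (CommRingCat.of (MvPolynomial (Fin n) A)) ⟶ Spec (.of A) :=
    Spec.map (CommRingCat.ofHom (algebraMap A (MvPolynomial (Fin n) A))) with hq
  set jK : Spec (CommRingCat.of (MvPolynomial (Fin n) K)) ⟶ Spec (CommRingCat.of (MvPolynomial (Fin n) A)) :=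
    Spec.map (CommRingCat.ofHom (MvPolynomial.map (algebraMap A K))) with hjK
  set qK : Spec (CommRingCat.of (MvPolynomial (Fin n) K)) ⟶ Spec (.of K) :=
    Spec.map (CommRingCat.ofHom (algebraMap K (MvPolynomial (Fin n) K))) with hqK
  have HK : IsPullback jK qK q (specOfAlgebra A K) := isPullback_specMap_mvPolynomial_map A K
  haveI : LocallyOfFiniteType q := by
    rw [hq, HasRingHomProperty.Spec_iff (P := @LocallyOfFiniteType)]
    exact RingHom.finiteType_algebraMap.mpr inferInstance
  haveI : LocallyOfFiniteType qK := by
    rw [hqK, HasRingHomProperty.Spec_iff (P := @LocallyOfFiniteType)]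
    exact RingHom.finiteType_algebraMap.mpr inferInstance
  haveI : IsLocallyNoetherian (Spec (CommRingCat.of (MvPolynomial (Fin n) K))) := inferInstance
  haveI : IsLocallyNoetherian (Spec (CommRingCat.of (MvPolynomial (Fin n) A))) :=
    LocallyOfFiniteType.isLocallyNoetherian q
  -- the ideal sheaf of `V(F)` and its generic restriction
  set 𝓘 : (Spec (CommRingCat.of (MvPolynomial (Fin n) A))).IdealSheafData :=
    affineBlowup.idealSheaf (univIdeal f) with h𝓘
  have h𝓘K : (affineZeroLocusι K n (univFamily n d l ((algebraMap A K).comp f))).ker = 𝓘.comap jK :=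
    ker_affineZeroLocusι_univFamily f K (algebraMap A K)
  -- ### the model tower and its model data over `D(a₁)` (clause (i))
  obtain ⟨s, hs⟩ := CentreSeq.exists_comap_eq_of_isPullback_generic K sK q jK qK HK
  have hres' : (s.comap jK).IsResolutionOf ⟨𝓘.comap jK, [], 1⟩ := by
    rw [hs, ← h𝓘K]
    exact hresK
  obtain ⟨a₁, ha₁, hMD⟩ := CentreSeq.exists_modelDataAt K s q jK qK HK 𝓘 [] hres'
  -- ### clause (ii) over some `D(a₂)`
  obtain ⟨b, hb, hflat⟩ := exists_flat_modelZeroLocusToSpec f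
  have hshape : ∃ a₂ : A, a₂ ≠ 0 ∧ ∀ (k : Type) [Field k] [PerfectField k] (φ : A →+* k), φ a₂ ≠ 0 →
      IsIntegral (affineZeroLocus k n (univFamily n d l (φ.comp f))) →
      ∀ (U : Scheme.{0}) (j : U ⟶ Spec (CommRingCat.of (MvPolynomial (Fin n) k))) [IsOpenImmersion j],
        (∀ y : affineZeroLocus k n (univFamily n d l (φ.comp f)),
          affineZeroLocusι k n (univFamily n d l (φ.comp f)) y ∈ Set.range j →
            IsRegularLocalRing ((affineZeroLocus k n (univFamily n d l (φ.comp f))).presheaf.stalk y)) →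
        ((s.comap (Spec.map (CommRingCat.ofHom (MvPolynomial.map φ)))).restrict j).IsExtensionOfSingle
          ((affineZeroLocusι k n (univFamily n d l (φ.comp f))).ker.comap j) := by
    by_cases hdom : IsDomain (MvPolynomial (Fin n) K ⧸
        Ideal.span (univFamily n d l ((algebraMap A K).comp f) : Set (MvPolynomial (Fin n) K)))
    · -- integral generic zero scheme: the shape spreads
      have hint : IsIntegral (affineZeroLocus K n (univFamily n d l ((algebraMap A K).comp f))) :=
        (isIntegral_affineZeroLocus_iff K _).mpr hdom
      have hiiK' := hiiK hint
      rw [← hs] at hiiK'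
      obtain ⟨a₂, ha₂, hSO⟩ := exists_forall_isSingleOff_comap K f s hint hiiK' hb hflat
      refine ⟨a₂ * b, mul_ne_zero ha₂ hb, fun k _ _ φ hφ _ U j _ hreg => ?_⟩
      rw [map_mul] at hφ
      have hSOφ := hSO k φ (left_ne_zero_of_mul hφ)
      rw [← ker_affineZeroLocusι_univFamily f k φ] at hSOφ
      exact isExtensionOfSingle_restrict_of_isSingleOff f hflat k φ (right_ne_zero_of_mul hφ) hSOφ j hreg
    · -- non-integral generic zero scheme: no zero scheme nearby is integral
      obtain ⟨a₂, ha₂, hnd⟩ := Literature.AlgebraicGeometry.Limits.exists_forall_not_isDomain_mvPolynomial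
        K Literature.RingTheory.Flat.GortzWedhorn2020_10_83_holds (univIdeal f)
        (by rwa [map_univIdeal] )
      refine ⟨a₂, ha₂, fun k _ _ φ hφ hint => absurd ((isIntegral_affineZeroLocus_iff k _).mp hint) ?_⟩
      letI : Algebra A k := φ.toAlgebra
      have h := hnd k hφ
      rwa [show (algebraMap A k : A →+* k) = φ from rfl, map_univIdeal] at h
  obtain ⟨a₂, ha₂, hii⟩ := hshape
  -- ### conclusion over `D(a₁ a₂)`
  refine ⟨a₁ * a₂, mul_ne_zero ha₁ ha₂, fun k _ _ φ hφ => ?_⟩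
  rw [map_mul] at hφ
  refine ⟨s.comap (Spec.map (CommRingCat.ofHom (MvPolynomial.map φ))), ?_, fun hint U j _ _ hreg =>
    hii k φ (right_ne_zero_of_mul hφ) hint U j hreg⟩
  -- clause (i): restrict the model data to `q⁻¹ D(a₁)` and pass to the fibre
  have hMD' := CentreSeq.ModelDataAt.modelData_restrict a₁ s q jK 𝓘 [] hMD (q ⁻¹ᵁ basicOpen a₁).ι
    fun x => by rw [Scheme.Opens.range_ι]; rfl
  rw [List.map_nil] at hMD'
  exact isResolutionOf_comap_univFamily f hMD' k φ (left_ne_zero_of_mul hφ)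

end Spread

/-! ## `SpreadsShapedFromGenericPoint` and the named fact from characteristic zero -/

/-- **The spreading-out step holds**: `SpreadsShapedFromGenericPoint n d l` for all `n d l`
(`hasShapedResolution_spread` for `A = ℤ[c]/𝔮`, whose fraction field has characteristic zero
when `𝔮` contains no prime number). [cite: BierstoneGrigorievMilmanWlodarczyk2011, Thm. 8.0.5 with Cor. 8.0.6–8.0.7] -/
theorem spreadsShapedFromGenericPoint_holds (n d l : ℕ) : SpreadsShapedFromGenericPoint n d l := by
  intro 𝔮 _ hchar hK
  haveI := charZero_fractionRing_quotient 𝔮 hchar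
  have halg : (algebraMap (CoeffRing n d l ⧸ 𝔮) (FractionRing (CoeffRing n d l ⧸ 𝔮))).comp
      (Ideal.Quotient.mk 𝔮) = algebraMap (CoeffRing n d l) (FractionRing (CoeffRing n d l ⧸ 𝔮)) :=
    rfl
  have hK' : HasShapedResolution (FractionRing (CoeffRing n d l ⧸ 𝔮)) n
      (univFamily n d l ((algebraMap (CoeffRing n d l ⧸ 𝔮) (FractionRing (CoeffRing n d l ⧸ 𝔮))).comp
        (Ideal.Quotient.mk 𝔮))) := by
    rw [halg]
    exact hK
  obtain ⟨a, ha, h⟩ := hasShapedResolution_spread (FractionRing (CoeffRing n d l ⧸ 𝔮))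
    (Ideal.Quotient.mk 𝔮) hK'
  obtain ⟨g, rfl⟩ := Ideal.Quotient.mk_surjective a
  refine ⟨g, fun hg => ha (Ideal.Quotient.eq_zero_iff_mem.mpr hg), fun k _ _ φ h𝔮 hφ => ?_⟩
  have H : ∀ x ∈ 𝔮, φ x = 0 := fun x hx => h𝔮 hx
  have hlift : (Ideal.Quotient.lift 𝔮 φ H).comp (Ideal.Quotient.mk 𝔮) = φ :=
    RingHom.ext fun x => Ideal.Quotient.lift_mk 𝔮 φ H
  have key := h k (Ideal.Quotient.lift 𝔮 φ H) (by rwa [Ideal.Quotient.lift_mk])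
  rwa [hlift] at key

/-- **`BierstoneGrigorievMilmanWlodarczyk2011_canonical` from its characteristic-zero
counterpart** (C0'): a shaped resolution for every `(𝔸ⁿ_K, (S), ∅, 1)`, `K` of characteristic
zero (BGMW Thm. 4.0.6). [cite: BierstoneGrigorievMilmanWlodarczyk2011, Thm. 8.0.5 with Cor. 8.0.6–8.0.7] -/
theorem canonical_of_charZero
    (h0 : ∀ (K : Type) [Field K] [CharZero K] (n : ℕ) (S : Finset (MvPolynomial (Fin n) K)),
      HasShapedResolution K n S) :
    BierstoneGrigorievMilmanWlodarczyk2011_canonical :=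
  canonical_of_charZero_of_spreads h0 spreadsShapedFromGenericPoint_holds

/-- **`BierstoneGrigorievMilmanWlodarczyk2011_canonical` from Kollár's Theorems 3.103 and 3.107.**
[cite: BierstoneGrigorievMilmanWlodarczyk2011, Thm. 8.0.5 with Cor. 8.0.6–8.0.7] -/
theorem canonical_of_kollarThms (h103 : Kollar2007Thm3_103.{0}) (h107 : Kollar2007Thm3_107.{0}) :
    BierstoneGrigorievMilmanWlodarczyk2011_canonical :=
  canonical_of_kollarThms_of_spreads h103 h107 spreadsShapedFromGenericPoint_holds

end Literature.AlgebraicGeometry.Resolution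

end
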